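import Summits.QuantumFields.BalabanUV.T4Continuum.Support.ShellMeasureExpHaarClosedBallSUN
import Summits.QuantumFields.BalabanUV.T4Continuum.Support.ShellMeasureExpHaarSU2

/-!
# `T4Continuum.ShellMeasureExpHaarKappaSUN` — (CH)₁: TWO ROUTES, ONE CONSTANT.  The normalising constant of the
# exponential-chart Haar density of `SU(N)` is UNIQUE, and the two kernel routes to it at `N = 2` — the quaternion chart
# (`ShellMeasureExpHaarSU2.kappaTwo = 2^{−3/2}(2π²)⁻¹`) and the Hausdorff route (`ShellMeasureExpHaarAreaSUN.kappaSU N =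
# (μ_H^{d_N}(SU(N)))⁻¹`) — AGREE; corollary: `μ_H³(SU(2)) = 2^{3/2}·2π²`
(cell `pub-balaban`, sub-cell `t4`, spine estimate NE7c (node U5b); NE7c formalisation swarm, ROUND-2 crew seat
`b2b-balaban-t4-ne7c-formalise-leaf-10` (gen 6); row S3 of `t4/b2b-balaban-t4-ne7c-p1/LEAVES-NE7c-P1.md` (c5: optional,
last) — a CONSISTENCY JUNCTION between offer EH (leaf-09-g5, `ShellMeasureExpHaarSU2`) and the (CH)₁ assembly (AF)/(CB)
(leaf-10-g5 with leaf-08-g6's STEP 1 and leaf-09-g6's STEP 2, `ShellMeasureExpHaar{Area,ClosedBall}SUN`); tree target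
`Summits/QuantumFields/BalabanUV/T4Continuum/Support/`; ADDITIVE — imports (CB) and EH f2 only, modifies nothing)

HONEST FRAMING.  Finite four-torus programme, rung (B)+1 only — NOT infinite volume, NOT a mass gap, NOT the Clay
problem, NOT summit progress.  Nothing of [Balaban 1983–89] is read, cited or asserted: classical measure theory on the
compact Lie group `SU(N)`; every declaration [folklore]; 0 sorry, 0 citations, no `def … : Prop`, no data def.  NE7c
(`T4IndicatorShell.ShellWeightBound`) is NOT PRINTED and NOT PROVED («NE7c ⇐ the named binders»); (CH)₁ is the optional
`SU(N)` road's chart identity and is ALREADY a theorem on both routes — this file removes no binder and moves nothing in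
the countdown (spine PROVED 0/9).

WHY THIS FILE.  S3 f5's engine `ShellMeasureRealizedSUN.slotAntiConcentration_realized_suN_expJac` carries the one-bond
chart identity (CH)₁ `hCH : Haar ⌞ expBallSU S = expPtSU_* (vol ⌞ B̄_S · κ · expJacSU)` with a FREE constant `κ`.  The
tree now discharges it twice, by two lineages sharing no normalisation input:
* route 1 (`N = 2` only): `ShellMeasureExpHaarSU2.hCH_two` transports the quaternion exponential chart of
  `T4HaarSU2ExpChart` and finds `κ₂ = kappaTwo = 2^{−3/2}·(2π²)⁻¹`;
* route 2 (every `N`): `ShellMeasureExpHaarAreaSUN.haar_restrict_expBallSU` / `…ClosedBallSUN.haar_restrict_expBallSU_le`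
  (Haar = normalised Hausdorff measure, the area formula, the Duhamel chart operator and its determinant) find
  `κ = kappaSU N = (μ_H^{d_N}(SU(N)))⁻¹`, a constant NOT computed in closed form.
The cell's rule «two independent engines before a constant is called certified», applied to the one numerical constant
of the (CH)₁ line, asks whether `kappaSU 2 = kappaTwo`.  A mis-scaled Lebesgue transport (`chartE3`, ratio `√2` in
dimension 3), a wrong Hausdorff dimension or metric scope (Frobenius vs operator norm), or a wrong Jacobian convention on
either side would make that equation FALSE.  It is TRUE, in kernel:
* §1 the chart integral `I_N(S) = ∫⁻_{B̄_S} expJacSU dvol`: the mass of the chart law is `κ · I_N(S)` (`chartLaw_univ`);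
  `I_N(S) < ∞` (`expJacSU ≤ 1`); `0 < I_N(S)` for `0 < S ≤ π` (`expJacSU = jacM` a.e., and `jacM = |det T_v| > 0` on the
  closed `π`-ball — (AF) §4, (CB) §2); hence the HAAR MASS OF THE EXPONENTIAL WINDOW `Haar (expBallSU S) = κ_N · I_N(S)`,
  positive for `S > 0` and at most `κ_N · vol(B̄_S)` (`haar_expBallSU_eq/_pos/_le`).
* §2 **`kappa_unique`**: if `hCH` holds for SOME constant `κ` at ONE window `0 < S ≤ π`, then `κ = κ_N` — equate the
  masses of the two chart laws and cancel the finite positive `I_N(S)`.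
* §3 **`kappaSU_two : kappaSU 2 = kappaTwo`** — route 1's `hCH_two` fed to §2; `example`: route 1's theorem re-derived
  from route 2.
* §4 **`hausdorffSU_two_univ : μ_H³(SU(2)) = 2^{3/2} · 2π²`** — the three-dimensional Euclidean Hausdorff measure of
  `SU(2) ⊂ (M₂(ℂ), Re Tr A*B)` is that of the round three-sphere of radius `√2` (`‖U‖_HS = √2`), as it must be;
  `haar_expBallSU_two`: the Haar mass of the `SU(2)` window as the explicit chart integral.

WHAT THIS DOES NOT DO.  Any instance of (S-i)/(S-ii), SM-L1…L8, (LR), (MR), (W1), the (F∞)-rate for Bałaban's measures;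
`μ_H^{d_N}(SU(N))` for `N ≥ 3` in closed form; nothing in the countdown moves.  HONEST DEPENDENCY (cell): continuum YM
on T⁴ ⇐ BetaPertH ∧ nine spine estimates (0/9 proved); BetaPertH ⇐ (D1) ∧ (D4) ∧ CAP+tail; G-an2-4 gates asym, D1 and
NE2/3/4.
-/

noncomputable section

namespace Summit.QuantumFields.BalabanUV.T4Continuum.ShellMeasureExpHaarKappaSUN

open MeasureTheory Measure Set Metric Function
open scoped ENNReal
open Literature.MathematicalPhysics.QuantumFieldTheory.Balaban1983to89
open ShellMeasureExpChartSUN ShellMeasureExpJacobianSUN ShellMeasureHaarHausdorffSUN ShellMeasureExpHaarAreaSUN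
  ShellMeasureExpHaarClosedBallSUN
open ShellMeasureScalingSUN (expBallSU)
open ShellMeasureExpDuhamelSUN (duhT)
open ShellMeasureExpHaarSU2 (kappaTwo hCH_two)

variable {N : ℕ}

/-! ## §1 The chart integral `I_N(S) = ∫⁻_{B̄_S} expJacSU` and the Haar mass of the exponential window -/

/-- THE MASS OF A CHART LAW: `(expPtSU_* (vol ⌞ B̄_S · κ·expJacSU)) (SU N) = κ · ∫⁻_{B̄_S} expJacSU`. [folklore] -/
theorem chartLaw_univ (κ : ℝ≥0∞) (S : ℝ) :
    ((((volume : Measure (ChartSU N)).restrict (closedBall 0 S)).withDensity (expJacWeightSU κ)).map expPtSU) univ =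
      κ * ∫⁻ v in closedBall (0 : ChartSU N) S, ENNReal.ofReal (expJacSU v) := by
  rw [Measure.map_apply measurable_expPtSU MeasurableSet.univ, preimage_univ, withDensity_apply _ MeasurableSet.univ,
    Measure.restrict_univ]
  exact lintegral_const_mul κ (ENNReal.measurable_ofReal.comp measurable_expJacSU)

/-- `I_N(S) ≤ vol(B̄_S)` (`expJacSU ≤ 1`). [folklore] -/
theorem lintegral_expJacSU_le (S : ℝ) :
    ∫⁻ v in closedBall (0 : ChartSU N) S, ENNReal.ofReal (expJacSU v) ≤ volume (closedBall (0 : ChartSU N) S) := by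
  calc ∫⁻ v in closedBall (0 : ChartSU N) S, ENNReal.ofReal (expJacSU v)
      ≤ ∫⁻ _ in closedBall (0 : ChartSU N) S, 1 := lintegral_mono fun v => by
        rw [← ENNReal.ofReal_one]
        exact ENNReal.ofReal_le_ofReal (expJacSU_le_one v)
    _ = volume (closedBall (0 : ChartSU N) S) := setLIntegral_one _

/-- `I_N(S) < ∞`. [folklore] -/
theorem lintegral_expJacSU_lt_top (S : ℝ) :
    ∫⁻ v in closedBall (0 : ChartSU N) S, ENNReal.ofReal (expJacSU v) < ∞ :=
  (lintegral_expJacSU_le S).trans_lt measure_closedBall_lt_top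

/-- the `normDet`-Jacobian of the chart is NON-ZERO on the closed `π`-ball (`jacM = |det T_v|`, (AF) §4, and
`0 < det T_v` there, (CB) §2). [folklore] -/
theorem jacM_ne_zero_of_norm_le_pi {v : ChartSU N} (hv : ‖v‖ ≤ Real.pi) : jacM v ≠ 0 := by
  rw [jacM_eq_abs_det]
  exact (ENNReal.ofReal_pos.mpr (abs_pos.mpr (det_duhT_pos_of_norm_le_pi hv).ne')).ne'

variable [NeZero N]

/-- `0 < I_N(S)` for `0 < S ≤ π`: `expJacSU = jacM` Lebesgue-a.e. ((AF) `jacM_ae_eq_expJacSU`) and `jacM ≠ 0` on the whole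
closed ball, which has positive Lebesgue measure. [folklore] -/
theorem lintegral_expJacSU_pos {S : ℝ} (h0 : 0 < S) (hS : S ≤ Real.pi) :
    0 < ∫⁻ v in closedBall (0 : ChartSU N) S, ENNReal.ofReal (expJacSU v) := by
  have hae : (jacM (N := N)) =ᵐ[volume.restrict (closedBall (0 : ChartSU N) S)]
      fun v => ENNReal.ofReal (expJacSU v) := ae_restrict_of_ae jacM_ae_eq_expJacSU
  have h1 : ∫⁻ v in closedBall (0 : ChartSU N) S, ENNReal.ofReal (expJacSU v) =
      ∫⁻ v in closedBall (0 : ChartSU N) S, jacM v := lintegral_congr_ae hae.symm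
  rw [h1, lintegral_pos_iff_support measurable_jacM, Measure.restrict_apply' measurableSet_closedBall]
  have hsub : closedBall (0 : ChartSU N) S ⊆ support (jacM (N := N)) ∩ closedBall 0 S := fun v hv =>
    ⟨jacM_ne_zero_of_norm_le_pi ((mem_closedBall_zero_iff.mp hv).trans hS), hv⟩
  exact (measure_closedBall_pos volume (0 : ChartSU N) h0).trans_le (measure_mono hsub)

/-- **THE HAAR MASS OF THE EXPONENTIAL WINDOW** `Haar (expBallSU S) = κ_N · I_N(S)` for `S ≤ π` ((CB)'s (CH)₁ at the
whole group). [folklore] -/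
theorem haar_expBallSU_eq {S : ℝ} (hS : S ≤ Real.pi) :
    (HaarData.haar : Measure (SUN N)) (expBallSU S) =
      kappaSU N * ∫⁻ v in closedBall (0 : ChartSU N) S, ENNReal.ofReal (expJacSU v) := by
  have h := congrArg (fun μ : Measure (SUN N) => μ univ) (haar_restrict_expBallSU_le (N := N) hS)
  simp only [Measure.restrict_apply MeasurableSet.univ, univ_inter] at h
  rw [h, chartLaw_univ]

/-- the exponential window of any positive radius `S ≤ π` has POSITIVE Haar mass. [folklore] -/
theorem haar_expBallSU_pos {S : ℝ} (h0 : 0 < S) (hS : S ≤ Real.pi) :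
    0 < (HaarData.haar : Measure (SUN N)) (expBallSU S) := by
  rw [haar_expBallSU_eq hS]
  exact ENNReal.mul_pos kappaSU_ne_zero (lintegral_expJacSU_pos h0 hS).ne'

/-- … and Haar mass at most `κ_N · vol(B̄_S)`. [folklore] -/
theorem haar_expBallSU_le {S : ℝ} (hS : S ≤ Real.pi) :
    (HaarData.haar : Measure (SUN N)) (expBallSU S) ≤ kappaSU N * volume (closedBall (0 : ChartSU N) S) := by
  rw [haar_expBallSU_eq hS]
  gcongr
  exact lintegral_expJacSU_le S

/-! ## §2 The constant of (CH)₁ is UNIQUE -/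

/-- **UNIQUENESS OF THE NORMALISING CONSTANT.**  If S3 f5's binder `hCH` holds with SOME constant `κ` at ONE window of
radius `0 < S ≤ π`, then `κ = κ_N = (μ_H^{d_N}(SU(N)))⁻¹`: both chart laws have mass `Haar (expBallSU S)`, i.e.
`κ · I_N(S) = κ_N · I_N(S)` with `0 < I_N(S) < ∞`. [folklore] -/
theorem kappa_unique {κ : ℝ≥0∞} {S : ℝ} (h0 : 0 < S) (hS : S ≤ Real.pi)
    (hCH : (HaarData.haar : Measure (SUN N)).restrict (expBallSU S) =
      (((volume : Measure (ChartSU N)).restrict (closedBall 0 S)).withDensity (expJacWeightSU κ)).map expPtSU) :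
    κ = kappaSU N := by
  have h := congrArg (fun μ : Measure (SUN N) => μ univ) hCH
  simp only [Measure.restrict_apply MeasurableSet.univ, univ_inter] at h
  rw [haar_expBallSU_eq hS, chartLaw_univ] at h
  exact ((ENNReal.mul_left_inj (lintegral_expJacSU_pos h0 hS).ne' (lintegral_expJacSU_lt_top S).ne).mp h).symm

/-- equivalently: (CH)₁ holds with constant `κ` at a window `0 < S ≤ π` IFF `κ = κ_N`. [folklore] -/
theorem hCH_iff {κ : ℝ≥0∞} {S : ℝ} (h0 : 0 < S) (hS : S ≤ Real.pi) :
    (HaarData.haar : Measure (SUN N)).restrict (expBallSU S) =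
      (((volume : Measure (ChartSU N)).restrict (closedBall 0 S)).withDensity (expJacWeightSU κ)).map expPtSU ↔
    κ = kappaSU N :=
  ⟨kappa_unique h0 hS, fun h => h ▸ haar_restrict_expBallSU_le hS⟩

/-! ## §3 `N = 2`: the quaternion-chart constant IS the Hausdorff constant -/

/-- **TWO ROUTES, ONE CONSTANT**: `κ_2 = (μ_H³(SU(2)))⁻¹` (Hausdorff route, every `N`) EQUALS
`κ₂ = 2^{−3/2}·(2π²)⁻¹` (quaternion route, `ShellMeasureExpHaarSU2.kappaTwo`) — route 1's `hCH_two` at the window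
`S = π` fed to `kappa_unique`. [folklore] -/
theorem kappaSU_two : kappaSU 2 = kappaTwo :=
  (kappa_unique (N := 2) Real.pi_pos le_rfl (hCH_two le_rfl)).symm

/-- route 1's theorem `ShellMeasureExpHaarSU2.hCH_two`, RE-DERIVED from route 2 ((CB) `haar_restrict_expBallSU_le` at
`N = 2` with `kappaSU_two`) — the two `N = 2` statements are one. [folklore] -/
example {S : ℝ} (hS : S ≤ Real.pi) :
    (HaarData.haar : Measure (SUN 2)).restrict (expBallSU S) =
      (((volume : Measure (ChartSU 2)).restrict (closedBall 0 S)).withDensity (expJacWeightSU kappaTwo)).map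
        expPtSU := by
  rw [← kappaSU_two]
  exact haar_restrict_expBallSU_le hS

/-! ## §4 Corollary: the Hausdorff volume of `SU(2)` -/

/-- **`μ_H³(SU(2)) = 2^{3/2} · 2π²`**: the three-dimensional Euclidean Hausdorff measure of `SU(2)` inside
`(M₂(ℂ), Re Tr A*B)` is the volume `2π²r³` of the round three-sphere of radius `r = √2` (`‖U‖_HS = √2` on `SU(2)`) —
read off `kappaSU_two`. [folklore] -/
theorem hausdorffSU_two_univ : hausdorffSU 2 univ = ENNReal.ofReal (Real.sqrt 2 ^ 3 * (2 * Real.pi ^ 2)) := by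
  have h : (hausdorffSU 2 univ)⁻¹ = ENNReal.ofReal ((Real.sqrt 2 ^ 3)⁻¹ * (2 * Real.pi ^ 2)⁻¹) := kappaSU_two
  have hpos : 0 < Real.sqrt 2 ^ 3 * (2 * Real.pi ^ 2) := by positivity
  rw [← mul_inv, ENNReal.ofReal_inv_of_pos hpos] at h
  exact inv_injective h

/-- the same number as a real: `(μ_H³(SU(2))).toReal = 2^{3/2}·2π² = 4·√2·π²`. [folklore] -/
theorem hausdorffSU_two_univ_toReal : (hausdorffSU 2 univ).toReal = 4 * Real.sqrt 2 * Real.pi ^ 2 := by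
  rw [hausdorffSU_two_univ, ENNReal.toReal_ofReal (by positivity)]
  have h2 : Real.sqrt 2 ^ 3 = 2 * Real.sqrt 2 := by
    rw [pow_succ, Real.sq_sqrt zero_le_two]
  rw [h2]; ring

/-- **THE HAAR MASS OF THE `SU(2)` WINDOW AS AN EXPLICIT CHART INTEGRAL**:
`Haar (expBallSU S) = 2^{−3/2}(2π²)⁻¹ · ∫_{‖v‖_HS ≤ S} expJacSU v dv` for `S ≤ π` (with `expJacSU v = sinc²(‖v‖/√2)`,
`ShellMeasureExpHaarSU2Chart.expJacSU_two`). [folklore] -/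
theorem haar_expBallSU_two {S : ℝ} (hS : S ≤ Real.pi) :
    (HaarData.haar : Measure (SUN 2)) (expBallSU S) =
      kappaTwo * ∫⁻ v in closedBall (0 : ChartSU 2) S, ENNReal.ofReal (expJacSU v) := by
  rw [← kappaSU_two]
  exact haar_expBallSU_eq hS

end Summit.QuantumFields.BalabanUV.T4Continuum.ShellMeasureExpHaarKappaSUN

end
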